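import Summits.CriticalPhenomena.Ising3DConformalLimit.Theorems.PerfectScreeningGaussianLimitNotScreenedRegressionDefs
import Summits.CriticalPhenomena.Ising3DConformalLimit.Theorems.PerfectScreeningGaussianLimitNotScreenedCrossTermLimit
import HarnessLib

/-!
# Crux `GaussianLimitNotScreened` (stmt-CriticalPhenomena-13886), line `single-layer-linear-regression`:
# the punctured-layer Riemann sum of stub B2b `stub_doubleTermKernelSum` (helper 2/2)

THEOREM-ONLY helper file (no definitions). The (limit) conjunct of the registered stub
`stub_doubleTermKernelSum` AWAY FROM THE SINGULARITY: under the crux hypotheses (a non-degenerate,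
Möbius-covariant pointwise scaling limit `(ρ, Δ, S)` of `criticalCorr 3`; no Gaussianity is used),
for every continuous profile `Φ` on `ℝ² = EuclideanSpace ℝ (Fin 2)` vanishing outside the ball of
radius `R` AND on the ball of radius `e > 0`,

  `Σ_{z ∈ ℤ², |zᵢ| ≤ Rn} n⁻² Φ(z/n) ⟨σ₀σ_{(0,z)}⟩_{β_c} / ⟨σ₀σ_{2n e₀}⟩_{β_c} → 4^Δ ∫ Φ(v) ‖v‖^{−2Δ} dv`.

Mechanism (the landed cross-term file `…CrossTermLimit.lean` read on the layer `{x₀ = 0}` instead of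
`{x₀ = n}`): at mesh `δ = 1/n` the lattice pair `(0, (0,z))` is EXACTLY the lattice approximation of
the continuum pair `(0, (0, z/n))`; uniform convergence of `ρ(1/n)² ⟨σ₀σ_·⟩` on the compact set of
configurations `(0, (0, w))`, `|wᵢ| ≤ R`, `‖w‖ ≥ e` (non-coincident since `e > 0`), and the radial
two-point function `S₂(0, y) = A‖y‖^{−2Δ}` (`two_point_radial`) give
`ρ(1/n)² ⟨σ₀σ_{(0,z)}⟩ → A ‖z/n‖^{−2Δ}` uniformly on `‖z/n‖ ≥ e` (where `Φ(z/n) ≠ 0`), and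
`ρ(1/n)² ⟨σ₀σ_{2n e₀}⟩ → A 2^{−2Δ}`; the numerator is `A` times a two-dimensional Riemann sum
(`crossTerm_tendsto_riemann_sum`) of the CONTINUOUS compactly supported `Φ‖·‖^{−2Δ}`
(`= Φ · (max ‖·‖ e)^{−2Δ}`), and `A / (A 2^{−2Δ}) = 4^Δ`.
-/

noncomputable section

namespace Summit.CriticalPhenomena.Ising3DConformalLimit.Cruxes.GaussianLimitNotScreened.SingleLayerLinearRegression

open MeasureTheory Filter Topology
open Literature.Probability.LatticeModels
open Summit.CriticalPhenomena.Ising3DConformalLimit.MoebiusLimitExistsNegative (two_point_radial)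


/-! ### The punctured layer at mesh `1/n` -/

/-- The lift `x ↦ (0, x) ∈ ℝ³` of the plane `ℝ²` is continuous. [folklore] -/
theorem doubleTermKernelSum_continuous_lift :
    Continuous fun x : Fin 2 → ℝ => (WithLp.toLp 2 (Fin.cons 0 x) : EuclideanSpace ℝ (Fin 3)) := by
  refine (PiLp.continuous_toLp 2 _).comp ?_
  refine continuous_pi fun i => ?_
  refine Fin.cases ?_ (fun j => ?_) i
  · simp only [Fin.cons_zero]; exact continuous_const
  · simp only [Fin.cons_succ]; exact continuous_apply j

/-- `‖(0, x)‖ = ‖x‖`. [folklore] -/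
theorem doubleTermKernelSum_norm_lift (x : Fin 2 → ℝ) :
    ‖(WithLp.toLp 2 (Fin.cons 0 x) : EuclideanSpace ℝ (Fin 3))‖ = ‖WithLp.toLp 2 x‖ := by
  rw [EuclideanSpace.norm_eq, EuclideanSpace.norm_eq, Fin.sum_univ_succ]
  simp

/-- At mesh `1/n` the layer point `(0, z) ∈ ℤ³` rescales EXACTLY to the continuum point `(0, z/n)`.
[folklore] -/
theorem doubleTermKernelSum_smul_siteVec_cons (n : ℕ) (z : Fin 2 → ℤ) :
    (n : ℝ)⁻¹ • siteVec (Fin.cons 0 z : Site 3) =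
      (WithLp.toLp 2 (Fin.cons 0 ((n : ℝ)⁻¹ • fun i => (z i : ℝ))) : EuclideanSpace ℝ (Fin 3)) := by
  ext i
  refine Fin.cases ?_ (fun j => ?_) i
  · simp [siteVec_apply]
  · simp [siteVec_apply]

/-- **The scaling limit read on the punctured layer, uniformly.** Under an `O(3)`+scale-covariant
pointwise scaling limit, `ρ(1/n)² ⟨σ₀σ_y⟩_{β_c}` is within `ε` of `A ‖x‖^{−2Δ}`, `A = S₂(0, e₀)`, for all
large `n`, uniformly over the lattice points `y` with `ŷ/n = (0, x)`, `x ∈ [-R, R]²`, `‖x‖ ≥ e > 0`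
(the configurations `(0, (0, x))` form a compact subset of the non-coincident ones). [folklore] -/
theorem doubleTermKernelSum_layer_uniform {ρ : ℝ → ℝ} {Δ : ℝ} {S : CorrFamily 3}
    (hlim : HasPointwiseScalingLimit (criticalCorr 3) ρ S) (hrot : IsRotationInvariant S)
    (hsc : IsScaleCovariant Δ S) (R : ℕ) {e : ℝ} (he : 0 < e) {ε : ℝ} (hε : 0 < ε) :
    ∀ᶠ n : ℕ in atTop, ∀ x ∈ Set.Icc (fun _ : Fin 2 => -(R : ℝ)) (fun _ => (R : ℝ)),
      e ≤ ‖WithLp.toLp 2 x‖ → ∀ y : Site 3,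
      (n : ℝ)⁻¹ • siteVec y = (WithLp.toLp 2 (Fin.cons 0 x) : EuclideanSpace ℝ (Fin 3)) →
        |ρ ((n : ℝ)⁻¹) ^ 2 * criticalTwoPoint 3 y -
            S 2 ![0, EuclideanSpace.single 0 1] * ‖WithLp.toLp 2 x‖ ^ (-(2 * Δ))| < ε := by
  set box' : Set (Fin 2 → ℝ) :=
    Set.Icc (fun _ : Fin 2 => -(R : ℝ)) (fun _ => (R : ℝ)) ∩ {x | e ≤ ‖WithLp.toLp 2 x‖} with hbox'
  set K : Set (Fin 2 → EuclideanSpace ℝ (Fin 3)) :=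
    (fun x : Fin 2 → ℝ => (![0, (WithLp.toLp 2 (Fin.cons 0 x) : EuclideanSpace ℝ (Fin 3))] :
      Fin 2 → EuclideanSpace ℝ (Fin 3))) '' box' with hK
  have hbc : IsCompact box' :=
    isCompact_Icc.inter_right (isClosed_le continuous_const (PiLp.continuous_toLp 2 _).norm)
  have hne : ∀ x ∈ box', (WithLp.toLp 2 (Fin.cons 0 x) : EuclideanSpace ℝ (Fin 3)) ≠ 0 := by
    intro x hx h0
    have h1 : ‖(WithLp.toLp 2 (Fin.cons 0 x) : EuclideanSpace ℝ (Fin 3))‖ = 0 := by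
      rw [h0, norm_zero]
    rw [doubleTermKernelSum_norm_lift] at h1
    have h2 : e ≤ ‖WithLp.toLp 2 x‖ := hx.2
    linarith
  have hKc : IsCompact K := by
    refine hbc.image ?_
    refine continuous_pi fun i => ?_
    fin_cases i
    · simpa using continuous_const
    · simpa using doubleTermKernelSum_continuous_lift
  have hKs : K ⊆ NonCoincident 3 2 := by
    rintro _ ⟨x, hx, rfl⟩
    exact pair_mem_nonCoincident (Ne.symm (hne x hx))
  have hU : TendstoUniformlyOn (rescaledCorrelator (criticalCorr 3) ρ 2) (S 2) (𝓝[>] 0) K :=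
    (tendstoLocallyUniformlyOn_iff_forall_isCompact (isOpen_nonCoincident 3 2)).1 (hlim 2) K hKs hKc
  have hev := crossTerm_tendsto_mesh.eventually (Metric.tendstoUniformlyOn_iff.1 hU ε hε)
  filter_upwards [hev, eventually_ge_atTop 1] with n hn h1 x hx hxe y hy
  have hn' : (0:ℝ) < n := by exact_mod_cast h1
  have hxb : x ∈ box' := ⟨hx, hxe⟩
  have h := hn _ ⟨x, hxb, rfl⟩
  dsimp only at h
  rw [← hy, crossTerm_rescaledCorrelator_pair ρ (inv_pos.2 hn') y, hy,
    two_point_radial hrot hsc (hne x hxb), Real.dist_eq, abs_sub_comm] at h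
  convert h using 3
  rw [mul_comm, doubleTermKernelSum_norm_lift]
  congr 1
  ring

/-! ### The far (punctured) layer Riemann sum -/

/-- **Registered bookkeeping sub-goal `doubleTermKernelSum_far` of stub B2b `stub_doubleTermKernelSum`
(the limit conjunct away from the singularity).** Under the crux hypotheses, for every continuous
profile `Φ` on `ℝ²` vanishing outside the ball of radius `R` AND on the ball of radius `e > 0`,
`Σ_{z ∈ ℤ², |zᵢ| ≤ Rn} n⁻² Φ(z/n) ⟨σ₀σ_{(0,z)}⟩_{β_c} / ⟨σ₀σ_{2n e₀}⟩_{β_c} → 4^Δ ∫ Φ(v) ‖v‖^{−2Δ} dv`: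
B1's mechanism on the layer — at mesh `1/n` the pair `(0, (0,z))` is exactly the lattice
approximation of `(0, (0, z/n))`, uniform convergence of `ρ(1/n)² ⟨σ₀σ_·⟩` on the compact set of
configurations `(0, (0,w))`, `|wᵢ| ≤ R`, `‖w‖ ≥ e`, the radial two-point function
`S₂(0, y) = A‖y‖^{−2Δ}`, a two-dimensional Riemann sum of the continuous compactly supported
`Φ‖·‖^{−2Δ}`, and `ρ(1/n)² ⟨σ₀σ_{2n e₀}⟩ → 2^{−2Δ} A`. [folklore] -/
theorem doubleTermKernelSum_far :
    ∀ (ρ : ℝ → ℝ) (Δ : ℝ) (S : CorrFamily 3), (∀ δ ∈ Set.Ioc (0:ℝ) 1, 0 < ρ δ) →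
      HasPointwiseScalingLimit (criticalCorr 3) ρ S → IsNondegenerateTwoPoint S →
      IsMoebiusCovariant Δ S →
      ∀ (Φ : E2 → ℝ) (R : ℕ) (e : ℝ), Continuous Φ → (∀ v : E2, (R : ℝ) ≤ ‖v‖ → Φ v = 0) →
        0 < e → (∀ v : E2, ‖v‖ ≤ e → Φ v = 0) →
        Tendsto (fun n : ℕ =>
            (∑ z ∈ layerBox R n, Φ ((n : ℝ)⁻¹ • planeVec z) / (n : ℝ) ^ 2 *
                criticalTwoPoint 3 (Fin.cons 0 z)) /
              criticalTwoPoint 3 (Pi.single 0 ((2 * n : ℕ) : ℤ)))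
          atTop (𝓝 ((4:ℝ) ^ Δ * ∫ v : E2, Φ v * ‖v‖ ^ (-(2 * Δ)))) := by
  intro ρ Δ S hρ hlim hnd hMo Φ R e hΦc hΦs he hΦe
  simp only [layerBox, planeVec]
  have hrot : IsRotationInvariant S := hMo.isEuclideanInvariant.2
  have hsc : IsScaleCovariant Δ S := hMo.isScaleCovariant
  -- the amplitude `A = S₂(0, e₀) > 0`
  set A : ℝ := S 2 ![0, EuclideanSpace.single 0 1] with hAdef
  have hA : 0 < A := hnd _ (zero_unitVec_mem_nonCoincident one_ne_zero)
  -- the continuum integrand (continuous: `Φ` kills the singularity)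
  set F : EuclideanSpace ℝ (Fin 2) → ℝ := fun v => Φ v * ‖v‖ ^ (-(2 * Δ)) with hFdef
  have hFeq : F = fun v => Φ v * (max ‖v‖ e) ^ (-(2 * Δ)) := by
    funext v
    simp only [hFdef]
    by_cases hv : ‖v‖ ≤ e
    · rw [hΦe v hv, zero_mul, zero_mul]
    · rw [max_eq_left (not_le.1 hv).le]
  have hFc : Continuous F := by
    rw [hFeq]
    refine hΦc.mul ?_
    refine Continuous.rpow_const (continuous_norm.max continuous_const) fun v => Or.inl ?_
    exact (lt_of_lt_of_le he (le_max_right _ _)).ne'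
  have hFs : ∀ v, (R : ℝ) ≤ ‖v‖ → F v = 0 := fun v hv => by simp [hFdef, hΦs v hv]
  -- (1) the denominator: `ρ(1/n)² G(2n e₀) → 2^{-2Δ} A`
  have hp : Tendsto (fun n : ℕ => ρ ((n:ℝ)⁻¹) ^ 2 * criticalTwoPoint 3 (Pi.single 0 ((2 * n : ℕ) : ℤ)))
      atTop (𝓝 ((2:ℝ) ^ (-(2:ℝ) * Δ) * A)) := by
    have hx : (![0, EuclideanSpace.single 0 2] : Fin 2 → EuclideanSpace ℝ (Fin 3)) ∈
        NonCoincident 3 2 := zero_unitVec_mem_nonCoincident two_ne_zero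
    have h1 := ((hlim 2).tendsto_at hx).comp crossTerm_tendsto_mesh
    have hne : (EuclideanSpace.single (0 : Fin 3) (2 : ℝ)) ≠ 0 := by
      intro h
      have := congrArg (fun v : EuclideanSpace ℝ (Fin 3) => v 0) h
      simp at this
    have hS : S 2 ![0, EuclideanSpace.single 0 2] = (2:ℝ) ^ (-(2:ℝ) * Δ) * A := by
      rw [two_point_radial hrot hsc hne, PiLp.norm_single, Real.norm_eq_abs, abs_two]
    rw [hS] at h1
    refine h1.congr' ?_
    filter_upwards [eventually_ge_atTop 1] with n hn
    have hn' : (0:ℝ) < n := by exact_mod_cast hn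
    simp only [Function.comp_apply]
    rw [← crossTerm_smul_siteVec_axis hn, crossTerm_rescaledCorrelator_pair ρ (inv_pos.2 hn')]
  -- (2) Riemann sums of `F` and of `|Φ|`
  have hRF := crossTerm_tendsto_riemann_sum hFc R hFs
  have hRabs := crossTerm_tendsto_riemann_sum (F := fun v => |Φ v|) hΦc.abs R
    (fun v hv => by simp [hΦs v hv])
  -- (3) the numerator: `Σ n⁻²Φ(z/n) ρ(1/n)² G((0,z)) → A ∫ F`
  have hN : Tendsto (fun n : ℕ =>
      ∑ u ∈ Fintype.piFinset (fun _ : Fin 2 => Finset.Icc (-((R * n : ℕ) : ℤ)) ((R * n : ℕ) : ℤ)),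
        Φ ((n : ℝ)⁻¹ • (WithLp.toLp 2 fun i => (u i : ℝ))) / (n : ℝ) ^ 2 *
          (ρ ((n:ℝ)⁻¹) ^ 2 * criticalTwoPoint 3 (Fin.cons 0 u)))
      atTop (𝓝 (A * ∫ v, F v)) := by
    have hM := hRF.const_mul A
    have hD : Tendsto (fun n : ℕ =>
        ∑ u ∈ Fintype.piFinset (fun _ : Fin 2 => Finset.Icc (-((R * n : ℕ) : ℤ)) ((R * n : ℕ) : ℤ)),
          Φ ((n : ℝ)⁻¹ • (WithLp.toLp 2 fun i => (u i : ℝ))) / (n : ℝ) ^ 2 *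
            (ρ ((n:ℝ)⁻¹) ^ 2 * criticalTwoPoint 3 (Fin.cons 0 u)) -
        A * ∑ u ∈ Fintype.piFinset (fun _ : Fin 2 => Finset.Icc (-((R * n : ℕ) : ℤ)) ((R * n : ℕ) : ℤ)),
          F ((n : ℝ)⁻¹ • (WithLp.toLp 2 fun i => (u i : ℝ))) / (n : ℝ) ^ 2)
        atTop (𝓝 0) := by
      rw [Metric.tendsto_nhds]
      intro ε hε
      set P : ℝ := ∫ v, |Φ v| with hPdef
      have hP : 0 ≤ P := integral_nonneg fun v => abs_nonneg _
      have hε₁ : 0 < ε / (P + 1) := by positivity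
      have hbd : ∀ᶠ n : ℕ in atTop,
          ∑ u ∈ Fintype.piFinset (fun _ : Fin 2 => Finset.Icc (-((R * n : ℕ) : ℤ)) ((R * n : ℕ) : ℤ)),
            |Φ ((n : ℝ)⁻¹ • (WithLp.toLp 2 fun i => (u i : ℝ)))| / (n : ℝ) ^ 2 < P + 1 :=
        hRabs.eventually (gt_mem_nhds (lt_add_one P))
      filter_upwards [hbd, doubleTermKernelSum_layer_uniform hlim hrot hsc R he hε₁,
        eventually_ge_atTop 1] with n hb hu hn
      rw [Real.dist_0_eq_abs, Finset.mul_sum, ← Finset.sum_sub_distrib]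
      have hterm : ∀ u ∈ Fintype.piFinset
          (fun _ : Fin 2 => Finset.Icc (-((R * n : ℕ) : ℤ)) ((R * n : ℕ) : ℤ)),
          |Φ ((n : ℝ)⁻¹ • (WithLp.toLp 2 fun i => (u i : ℝ))) / (n : ℝ) ^ 2 *
              (ρ ((n:ℝ)⁻¹) ^ 2 * criticalTwoPoint 3 (Fin.cons 0 u)) -
            A * (F ((n : ℝ)⁻¹ • (WithLp.toLp 2 fun i => (u i : ℝ))) / (n : ℝ) ^ 2)| ≤
          |Φ ((n : ℝ)⁻¹ • (WithLp.toLp 2 fun i => (u i : ℝ)))| / (n : ℝ) ^ 2 * (ε / (P + 1)) := by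
        intro u hu'
        by_cases hsmall : ‖(n : ℝ)⁻¹ • (WithLp.toLp 2 fun i => (u i : ℝ) : EuclideanSpace ℝ (Fin 2))‖ ≤ e
        · have h0 : Φ ((n : ℝ)⁻¹ • (WithLp.toLp 2 fun i => (u i : ℝ))) = 0 := hΦe _ hsmall
          have hF0 : F ((n : ℝ)⁻¹ • (WithLp.toLp 2 fun i => (u i : ℝ))) = 0 := by
            simp only [hFdef, h0, zero_mul]
          rw [h0, hF0]
          simp
        · have hx := crossTerm_smul_mem_box hn hu'
          have hxe : e ≤ ‖WithLp.toLp 2 ((n : ℝ)⁻¹ • fun i => (u i : ℝ))‖ := by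
            rw [WithLp.toLp_smul]; exact (not_le.1 hsmall).le
          have key := hu _ hx hxe (Fin.cons 0 u) (doubleTermKernelSum_smul_siteVec_cons n u)
          rw [WithLp.toLp_smul] at key
          have hsplit : Φ ((n : ℝ)⁻¹ • (WithLp.toLp 2 fun i => (u i : ℝ))) / (n : ℝ) ^ 2 *
                (ρ ((n:ℝ)⁻¹) ^ 2 * criticalTwoPoint 3 (Fin.cons 0 u)) -
              A * (F ((n : ℝ)⁻¹ • (WithLp.toLp 2 fun i => (u i : ℝ))) / (n : ℝ) ^ 2) =
              Φ ((n : ℝ)⁻¹ • (WithLp.toLp 2 fun i => (u i : ℝ))) / (n : ℝ) ^ 2 *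
                (ρ ((n:ℝ)⁻¹) ^ 2 * criticalTwoPoint 3 (Fin.cons 0 u) -
                  A * ‖(n : ℝ)⁻¹ • (WithLp.toLp 2 fun i => (u i : ℝ))‖ ^ (-(2 * Δ))) := by
            simp only [hFdef]; ring
          rw [hsplit, abs_mul, abs_div, abs_of_pos (by positivity : (0:ℝ) < (n:ℝ) ^ 2)]
          exact mul_le_mul_of_nonneg_left key.le (by positivity)
      calc |∑ u ∈ Fintype.piFinset (fun _ : Fin 2 => Finset.Icc (-((R * n : ℕ) : ℤ)) ((R * n : ℕ) : ℤ)),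
              (Φ ((n : ℝ)⁻¹ • (WithLp.toLp 2 fun i => (u i : ℝ))) / (n : ℝ) ^ 2 *
                (ρ ((n:ℝ)⁻¹) ^ 2 * criticalTwoPoint 3 (Fin.cons 0 u)) -
              A * (F ((n : ℝ)⁻¹ • (WithLp.toLp 2 fun i => (u i : ℝ))) / (n : ℝ) ^ 2))|
          ≤ ∑ u ∈ Fintype.piFinset (fun _ : Fin 2 => Finset.Icc (-((R * n : ℕ) : ℤ)) ((R * n : ℕ) : ℤ)),
              |Φ ((n : ℝ)⁻¹ • (WithLp.toLp 2 fun i => (u i : ℝ)))| / (n : ℝ) ^ 2 * (ε / (P + 1)) :=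
            (Finset.abs_sum_le_sum_abs _ _).trans (Finset.sum_le_sum hterm)
        _ = (∑ u ∈ Fintype.piFinset (fun _ : Fin 2 => Finset.Icc (-((R * n : ℕ) : ℤ)) ((R * n : ℕ) : ℤ)),
              |Φ ((n : ℝ)⁻¹ • (WithLp.toLp 2 fun i => (u i : ℝ)))| / (n : ℝ) ^ 2) * (ε / (P + 1)) := by
            rw [Finset.sum_mul]
        _ < (P + 1) * (ε / (P + 1)) := mul_lt_mul_of_pos_right hb hε₁
        _ = ε := by field_simp
    have := hD.add hM
    rw [zero_add] at this
    refine this.congr' (Eventually.of_forall fun n => ?_)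
    simp only [sub_add_cancel]
  -- (4) assemble: divide numerator by denominator and cancel `ρ(1/n)²`
  have hden : (2:ℝ) ^ (-(2:ℝ) * Δ) * A ≠ 0 := (mul_pos (Real.rpow_pos_of_pos two_pos _) hA).ne'
  have hmain := hN.div hp hden
  have hconst : A * (∫ v, F v) / ((2:ℝ) ^ (-(2:ℝ) * Δ) * A) = (4:ℝ) ^ Δ * ∫ v, F v := by
    rw [mul_comm ((2:ℝ) ^ (-(2:ℝ) * Δ)) A, mul_div_mul_left _ _ hA.ne',
      show -(2:ℝ) * Δ = -(2 * Δ) by ring, Real.rpow_neg two_pos.le, div_inv_eq_mul,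
      Real.rpow_mul two_pos.le, Real.rpow_two, mul_comm]
    norm_num
  rw [hconst] at hmain
  refine hmain.congr' ?_
  filter_upwards [eventually_ge_atTop 1] with n hn
  have hn' : (0:ℝ) < n := by exact_mod_cast hn
  have hρn : ρ ((n:ℝ)⁻¹) ^ 2 ≠ 0 :=
    (pow_pos (hρ _ ⟨inv_pos.2 hn', inv_le_one_of_one_le₀ (by exact_mod_cast hn)⟩) 2).ne'
  rw [← mul_div_mul_left _ (criticalTwoPoint 3 (Pi.single 0 ((2 * n : ℕ) : ℤ))) hρn, Finset.mul_sum,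
    Pi.div_apply]
  congr 1
  refine Finset.sum_congr rfl fun u _ => ?_
  ring

end Summit.CriticalPhenomena.Ising3DConformalLimit.Cruxes.GaussianLimitNotScreened.SingleLayerLinearRegression

end
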